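import Mathlib
import HarnessLib
import Literature.AlgebraicGeometry.Ramification.InertiaNormalSylow
import Literature.AlgebraicGeometry.Ramification.NormalSylowExtensions
import Literature.AlgebraicGeometry.Resolution.RsopMonomialIdeals
import Literature.AlgebraicGeometry.Resolution.RegularCentreRsopPart
import Summits.ResolutionOfSingularities.ResolutionOfSingularities.Theorems.WildQuotientsWildQuotientResolutionStubInertiaLe
import Summits.ResolutionOfSingularities.ResolutionOfSingularities.Theorems.WildQuotientsWildQuotientResolutionCentreGenerators
import Summits.ResolutionOfSingularities.ResolutionOfSingularities.Theorems.WildQuotientsWildQuotientResolutionCentreRsop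
import Summits.ResolutionOfSingularities.ResolutionOfSingularities.Theorems.WildQuotientsWildQuotientResolutionCentreBlowupInertia

/-!
# Blowing up a regular stable curve on a regular threefold does not create non-p-closed inertia (crux `WildQuotients.WildQuotientResolution`, Phase 0, dimension 3)

Crux stmt-ResolutionOfSingularities-15640 (`WildQuotientResolution`), line `Sketch` (card
`p-closure-sylow-separation`), registered stub `stub_phaseZeroHighDim` (= PhaseZeroModel for
`dim X′ ≥ 3`). The surface theorem `PhaseZeroDimTwo.phaseZero_dimLE_two` kills the non-p-closed
inertia locus NPC by ONE blow-up of finitely many points. In dimension `3` the NPC locus has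
curve components, and the Phase-0 strategy recorded in the crux notes is: regularise the NPC
curves by point blow-ups, then blow the (regular, `G`-stable) curves up. This file proves the
curve step in scheme form: for the equivariant blow-up `π : X♯ → X′` of a `G`-stable ideal sheaf
`𝒥` with REGULAR subscheme of codimension `2` in an ambient with regular local rings of dimension
`≤ 3` along it,

  `NPC(X♯) ⊆ π⁻¹ (NPC(X′) ∖ V(𝒥))`                      (`npc_subset_of_regularCurveBlowup`):

over the centre every inertia group is p-closed (`CentreBlowupInertia` + the codimension-`2`
algebra `flagCore_data_of_isRsopPart_two_of_le`, which also covers the generic point of the curve,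
`dim 𝒪_z = 2`), and off the centre inertia can only shrink (`I_x ≤ I_{π x}`,
`InertiaLe.stub_inertia_le`). The residue characteristics are hypotheses (over a field of
characteristic `p`: `PhaseZeroDimTwo.charP_residueField`).

* `hasNormalSylow_inertia_of_equivariant` — along ANY equivariant morphism, p-closed inertia at
  `π x` forces p-closed inertia at `x`.
* `flagCore_data_of_isRsopPart_two_of_le` — `CentreRsop.flagCore_data_of_isRsopPart_two` with
  `dim R ≤ 3` instead of `= 3` (the generic point of the curve: `dim R = 2`, `J̄ = V`).
* `hasNormalSylow_inertia_of_regularCentreBlowup` — over a blown-up regular stable centre of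
  codimension `2` at a point with `dim 𝒪_z ≤ 3`, inertia is p-closed.
* `npc_subset_of_regularCurveBlowup` — the theorem.

[OURS · crux stmt-ResolutionOfSingularities-15640 · helper toward `stub_phaseZeroHighDim`; counted
0; AI-level work, weaker than expert review.]
-/

-- single-problem summit: the doubled namespace component `ResolutionOfSingularities` is forced
set_option linter.dupNamespace false

namespace Summit.ResolutionOfSingularities.ResolutionOfSingularities.Theorems.WildQuotientResolution.CurveBlowupNpc

open CategoryTheory AlgebraicGeometry TopologicalSpace IsLocalRing
open Literature.AlgebraicGeometry.Resolution Literature.AlgebraicGeometry.Ramification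
open Summit.ResolutionOfSingularities.ResolutionOfSingularities.Theorems.WildQuotientResolution.CentreGenerators
open Summit.ResolutionOfSingularities.ResolutionOfSingularities.Theorems.WildQuotientResolution.CentreRsop
open Summit.ResolutionOfSingularities.ResolutionOfSingularities.Theorems.WildQuotientResolution.CentreBlowupInertia

/-! ## Inertia only shrinks along equivariant morphisms -/

/-- **Along an equivariant morphism inertia only shrinks**: for `π : X → Y` equivariant for
actions `σ` on `X` and `τ` on `Y` of a finite group, if the inertia group of `π x` is p-closed
then so is the inertia group of `x` (`I_x ≤ I_{π x}`, `InertiaLe.stub_inertia_le`, as in `PhaseZeroDimTwo.hasNormalSylow_of_le`). In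
particular a blow-up creates non-p-closed inertia only over non-p-closed inertia. [folklore] -/
theorem hasNormalSylow_inertia_of_equivariant {p : ℕ} [Fact p.Prime] {G : Type} [Group G]
    [Finite G] {X Y : Scheme.{0}} (σ : G →* Aut X) (τ : G →* Aut Y) (π : X ⟶ Y)
    (hπ : ∀ g : G, (σ g).hom ≫ π = π ≫ (τ g).hom) (x : X)
    (h : HasNormalSylow p (inertiaSubgroup τ (π.base x))) :
    HasNormalSylow p (inertiaSubgroup σ x) :=
  (h.subgroup ((inertiaSubgroup σ x).subgroupOf (inertiaSubgroup τ (π.base x)))).of_mulEquiv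
    (Subgroup.subgroupOfEquivOfLe (InertiaLe.stub_inertia_le σ τ π hπ x))

/-! ## The codimension-2 algebra with `dim R ≤ 3` -/

section LocalRing

variable {R : Type*} [CommRing R] [IsLocalRing R]

/-- `CentreRsop.flagCore_data_of_isRsopPart_two` with `dim R ≤ 3`: for `c : Fin 2 → R` part of
a regular system of parameters of a regular local ring of dimension `≤ 3` (so `2` or `3`) and
`J = (c₀, c₁)`, the four flag hypotheses of `FlagCore.stub_flagCore` hold (`v₀ = 0` when
`dim R = 2`, i.e. `J = 𝔪`: the generic point of a curve on a threefold). [folklore] -/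
theorem flagCore_data_of_isRsopPart_two_of_le {c : Fin 2 → R} (hc : IsRsopPart c)
    (hdim : ringKrullDim R ≤ (3 : ℕ)) {J : Ideal R} (hJ : Ideal.span (Set.range c) = J) :
    J ≤ maximalIdeal R ∧
      J ⊓ maximalIdeal R ^ 2 ≤ maximalIdeal R * J ∧
      (∃ j₁' ∈ J, ∃ j₂' ∈ J, ∀ j ∈ J, ∃ a b : R,
        j - (a * j₁' + b * j₂') ∈ maximalIdeal R ^ 2) ∧
      (∃ v ∈ maximalIdeal R, ∀ r ∈ maximalIdeal R, ∃ a : R, ∃ j ∈ J,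
        r - (a * v + j) ∈ maximalIdeal R ^ 2) := by
  obtain ⟨e, y, hde, hspan⟩ := hc.2
  have he : 2 + e ≤ 3 := by
    rw [hde] at hdim
    exact_mod_cast hdim
  have hrange : Set.range c = {c 0, c 1} := by
    ext a
    simp only [Set.mem_range, Fin.exists_fin_two, Set.mem_insert_iff, Set.mem_singleton_iff,
      eq_comm]
  have hind : ∀ a b : R, a * c 0 + b * c 1 ∈ maximalIdeal R ^ 2 →
      a ∈ maximalIdeal R ∧ b ∈ maximalIdeal R := fun a b h => by
    have h' : ∑ i, (![a, b] : Fin 2 → R) i * c i ∈ maximalIdeal R ^ 2 := by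
      rw [Fin.sum_univ_two]
      simpa using h
    have hall := forall_mem_of_sum_mul_mem_sq hc (![a, b]) h'
    exact ⟨by simpa using hall 0, by simpa using hall 1⟩
  -- a third generator `v₀` of `𝔪` (`= 0` if `dim R = 2`)
  obtain ⟨v₀, hm⟩ : ∃ v₀ : R, maximalIdeal R = Ideal.span {v₀, c 0, c 1} := by
    rcases Nat.le_one_iff_eq_zero_or_eq_one.mp (by omega : e ≤ 1) with rfl | rfl
    · refine ⟨0, ?_⟩
      rw [Ideal.span_insert_zero, ← hrange, ← hspan, Set.range_eq_empty y, Set.union_empty]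
    · refine ⟨y 0, ?_⟩
      have hy : Set.range y = {y 0} := by
        rw [Set.range_unique]
        rfl
      rw [← hspan, hrange, hy, Set.union_singleton]
  exact flagCore_data_of_generators (j₁ := c 0) (j₂ := c 1) (v₀ := v₀) (by rw [← hJ, hrange])
    hm hind

end LocalRing

/-! ## Over the centre -/

/-- **Over a blown-up regular stable centre of codimension `2`, at points with `dim 𝒪_z ≤ 3`,
inertia is p-closed** (`CentreBlowupInertia.hasNormalSylow_inertia_of_regularCentreBlowup_three`
extended to the generic point of the curve). [folklore] -/
theorem hasNormalSylow_inertia_of_regularCentreBlowup (p : ℕ) [Fact p.Prime]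
    {X' X₁ : Scheme.{0}} (q : X' ⟶ X₁) [IsAffineHom q]
    {G : Type} [Group G] [Finite G] (ρ : G →* Aut X') (hfaith : Function.Injective ρ)
    (hρ : ∀ g : G, (ρ g).hom ≫ q = q) [IsIntegral X'] [IsLocallyNoetherian X']
    (𝒥 : X'.IdealSheafData) (h𝒥 : ∀ g : G, 𝒥.comap (ρ g).hom = 𝒥)
    (hC : Literature.AlgebraicGeometry.Resolution.Scheme.IsRegular 𝒥.subscheme)
    {Xs : Scheme.{0}} {π : Xs ⟶ X'} (hπ : IsBlowup π 𝒥) [IsIntegral Xs]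
    (ρs : G →* Aut Xs) (hequiv : ∀ g : G, (ρs g).hom ≫ π = π ≫ (ρ g).hom) (x : Xs)
    [CharP (ResidueField (X'.presheaf.stalk (π.base x))) p]
    [CharP (ResidueField (Xs.presheaf.stalk x)) p]
    [IsRegularLocalRing (X'.presheaf.stalk (π.base x))]
    (hx : π.base x ∈ 𝒥.support)
    (hdim : ringKrullDim (X'.presheaf.stalk (π.base x)) ≤ (3 : ℕ))
    (hcodim : ringKrullDim (X'.presheaf.stalk (π.base x) ⧸ stalkIdeal 𝒥 (π.base x)) + ((2 : ℕ) : ℕ) =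
      ringKrullDim (X'.presheaf.stalk (π.base x))) :
    HasNormalSylow p (inertiaSubgroup ρs x) := by
  obtain ⟨c, hc, hcJ⟩ := exists_isRsopPart_fin_span_range_eq_stalkIdeal hC hx hcodim
  obtain ⟨hJm, hJ2, hJgen, hVgen⟩ := flagCore_data_of_isRsopPart_two_of_le hc hdim hcJ
  exact hasNormalSylow_inertia_of_centreBlowup p q ρ hfaith hρ 𝒥 h𝒥 hπ ρs hequiv x hJm hJ2 hJgen
    hVgen

/-! ## The theorem -/

/-- **Blowing up a regular stable curve on a regular threefold does not create non-p-closed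
inertia: `NPC(X♯) ⊆ π⁻¹(NPC(X′) ∖ V(𝒥))`.** Let `X′` be integral, locally Noetherian, with regular
local rings of dimension `≤ 3`, carrying a faithful action `ρ` of the finite group `G` over the
affine `q`; `𝒥` a `G`-stable ideal sheaf with regular subscheme `V(𝒥)` of codimension `2` at each
of its points (`dim 𝒪_{V(𝒥),z} + 2 = dim 𝒪_{X′,z}`); `π : X♯ → X′` the blow-up of `𝒥` with the
lifted action `ρs`; all residue fields of characteristic `p`. If the inertia group of a point
`x ∈ X♯` is NOT p-closed, then `π x ∉ V(𝒥)` and the inertia group of `π x` is not p-closed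
either. [folklore] -/
theorem npc_subset_of_regularCurveBlowup (p : ℕ) [Fact p.Prime]
    {X' X₁ : Scheme.{0}} (q : X' ⟶ X₁) [IsAffineHom q]
    {G : Type} [Group G] [Finite G] (ρ : G →* Aut X') (hfaith : Function.Injective ρ)
    (hρ : ∀ g : G, (ρ g).hom ≫ q = q) [IsIntegral X'] [IsLocallyNoetherian X']
    (hreg : ∀ z : X', IsRegularLocalRing (X'.presheaf.stalk z))
    (hdim : ∀ z : X', ringKrullDim (X'.presheaf.stalk z) ≤ (3 : ℕ))
    (𝒥 : X'.IdealSheafData) (h𝒥 : ∀ g : G, 𝒥.comap (ρ g).hom = 𝒥)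
    (hC : Literature.AlgebraicGeometry.Resolution.Scheme.IsRegular 𝒥.subscheme)
    (hcodim : ∀ z ∈ 𝒥.support,
      ringKrullDim (X'.presheaf.stalk z ⧸ stalkIdeal 𝒥 z) + ((2 : ℕ) : ℕ) =
        ringKrullDim (X'.presheaf.stalk z))
    {Xs : Scheme.{0}} {π : Xs ⟶ X'} (hπ : IsBlowup π 𝒥) [IsIntegral Xs]
    (ρs : G →* Aut Xs) (hequiv : ∀ g : G, (ρs g).hom ≫ π = π ≫ (ρ g).hom)
    (hcharX : ∀ z : X', CharP (ResidueField (X'.presheaf.stalk z)) p)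
    (hcharS : ∀ x : Xs, CharP (ResidueField (Xs.presheaf.stalk x)) p)
    (x : Xs) (hx : ¬ HasNormalSylow p (inertiaSubgroup ρs x)) :
    π.base x ∉ 𝒥.support ∧ ¬ HasNormalSylow p (inertiaSubgroup ρ (π.base x)) := by
  refine ⟨fun hmem => hx ?_, fun h => hx (hasNormalSylow_inertia_of_equivariant ρs ρ π hequiv x h)⟩
  haveI := hreg (π.base x)
  haveI := hcharX (π.base x)
  haveI := hcharS x
  exact hasNormalSylow_inertia_of_regularCentreBlowup p q ρ hfaith hρ 𝒥 h𝒥 hC hπ ρs hequiv x hmem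
    (hdim _) (hcodim _ hmem)

end Summit.ResolutionOfSingularities.ResolutionOfSingularities.Theorems.WildQuotientResolution.CurveBlowupNpc
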